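import Summits.BirchSwinnertonDyer.Rank1Residual.P2.CongruentNumberSilentEvenFiveEnclosureListing
import Literature.NumberTheory.EllipticCurves.Tian2014.CMPointSystemBridgeAutUnits
import HarnessLib

/-!
# Cell `bsd-monsky` (typer), route A: C-P2-1 on `𝒮⁻` from the UNITS aut system display ALONE — the corner of record
# (`…_of_autSystemListing_descent (hSys¹¹)`, referee B ROUND 816) with Tian's sentence «`T(B²) = −1`» struck as well

HONEST FRAMING (cell `bsd-monsky`, run/shared/lean/pub/bsd-monsky/; README §1): ONE theorem on ONE explicit infinite
family of quadratic twists of the congruent number curve at the prime `2`; not "BSD for rank ≤ 1", nothing at odd primes;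
nothing is booked by this file. The corner of record of route A (referee B ROUND 816, 2026-08-27T15:54Z) is
`congruentSilentEvenFiveBSDTwo_of_autSystemListing_descent (hSys¹¹)`. A further derivability pass over the displayed
hypothesis (`Literature/…/Tian2014/CMPointSystemBridgeAutUnits.lean`) found one more displayed sentence that is a kernel
consequence of the others: Tian's «as `T(B²)` is the multiplication by `−1`» (the M4 split's display `tianTBSq`, Prop. 2.1
proof) — `E′(ℂ)` is not killed by `2` by TYZ's two sentences on `τ`, the CM sentence and «`Aut(E′_ℂ) ≅ ℤ[i]^×`», and then
`T(B)` and `[i]`, both of order `4` in `ℤ[i]^×`, have the same square `−1` — and proved it; `tian2014_system_sMinus_autUnits`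
(`hSys¹²`) is `hSys¹¹` without that sentence, and the two facts are EQUIVALENT in the kernel
(`tian2014_system_sMinus_autListing_iff_autUnits`). This file is the corner on the units display:
`congruentSilentEvenFiveBSDTwo_of_autSystemUnits_descent (hSys¹² : tian2014_system_sMinus_autUnits)` — the `2`-Selmer input
the tree's complete `2`-descent (`#Sel⁽²⁾(E_{2pq}/ℚ) ≤ 8`, p480559), rank one the tree's first `2`-descent (p457453 / p458378)
— with the rank axis, clause (a) and both typed forms from the same binder (proofs: one-line compositions of the corner of
record A¹¹-desc / its rank rows, p543727, with `tian2014_system_sMinus_autListing_of_autUnits`). Marks of record untouched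
(the readings P `tyzPhiParam` and M5 `tyzZN` are re-used by name inside `AutUnitsParamCuspDisplays`, displayed verbatim as
before). CONDITIONAL on the one (units) system display; nothing asserted; the conjecture `Prop`s stay `@[conjecture]`.
[cite: Tian2014, Thm. 2.8 (J132), Def. 2.7, Prop. 2.1 (p0006 L23–L75), p0007 L28–L29, p0003 L3–L5 (J119), §4.2 (p0022 L52–L60), Notations (i)–(iii) (J122 L41–54), Prop. 4.6 proof (p0023 L26–L28)]
[cite: TianYuanZhang2017, Thm. 3.3 (p. 739), p. 749, J733, J741, J747, J751, Lemma 3.16 (J754)]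
[cite: SilvermanAEC2009, Prop. X.1.4, Prop. X.4.9, Thm. X.4.2] [cite: Miller2011LMS, Def. 1.1 (arXiv:1010.2431 p. 3)]
[cite: Lagrange1975, §11 table p. 16-12] [cite: Monsky1990MockHeegner, p. 52 ¶2]
-/

noncomputable section

open scoped Classical

open WeierstrassCurve Literature.NumberTheory.EllipticCurves
  Literature.NumberTheory.EllipticCurves.Rank1Residual.Typed

set_option autoImplicit false

namespace Summit.BirchSwinnertonDyer.Rank1Residual.P2

open Conjectures Literature.NumberTheory.EllipticCurves.Tian2014

/-! ## §1 C-P2-1 on `𝒮⁻` from the units aut display ALONE -/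

/-- **C-P2-1 = Theorem 1.1 on `𝒮⁻` from the UNITS aut system display `hSys¹²` ALONE** — the corner of record
(`…_of_autSystemListing_descent (hSys¹¹)`, ROUND 816) with Tian's sentence «as `T(B²)` is the multiplication by `−1`» struck
from the displayed hypothesis as well (it is a kernel theorem of the other displayed sentences: `E′(ℂ)` is not killed by `2`,
then `T(B)² = [i]² = −1` in `ℤ[i]^×`); the `2`-Selmer input is the tree's complete `2`-descent. CONDITIONAL on the one units
system display; nothing asserted.
[cite: Tian2014, Thm. 2.8 (J132), Def. 2.7, Prop. 2.1 (p0006 L23–L75), p0007 L28–L29, p0003 L3–L5 (J119), Notations (i)–(iii) (J122 L41–54), Prop. 4.6 proof (p0023 L26–L28)]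
[cite: TianYuanZhang2017, Thm. 3.3 (p. 739), p. 749, J733, J741, J747, J751, Lemma 3.16 (J754)]
[cite: SilvermanAEC2009, Prop. X.1.4, Prop. X.4.9, Thm. X.4.2] [cite: Miller2011LMS, Def. 1.1 (arXiv:1010.2431 p. 3)] -/
theorem congruentSilentEvenFiveBSDTwo_of_autSystemUnits_descent (hSys : tian2014_system_sMinus_autUnits) :
    CongruentSilentEvenFiveBSDTwo :=
  congruentSilentEvenFiveBSDTwo_of_autSystemListing_descent (tian2014_system_sMinus_autListing_of_autUnits hSys)

/-! ## §2 The rank axis and the sharper form from the units aut display ALONE -/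

/-- **C-P2-1, SHARPER (`Ш_an`-unit) FORM, from the units aut system display ALONE** (`hSys¹²`): clause (a) and
`#Ш_an(E_{2pq})` a `2`-adic unit on all of `𝒮⁻` with NO `2`-Selmer input (the first `2`-descent of Lagrange 1975 in the
kernel and the system's own point). CONDITIONAL; nothing asserted.
[cite: Tian2014, Def. 2.7, Prop. 2.1 (p0006 L23–L75), p0007 L28–L29, p0003 L3–L5 (J119), Notations (i)–(iii) (J122 L41–54)]
[cite: TianYuanZhang2017, Thm. 3.3, J733, J741, J747, J751, Lemma 3.16 (J754)] [cite: Lagrange1975, §11 table p. 16-12] -/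
theorem congruentSilentEvenFiveOrdTwo_of_autSystemUnits_rankDescent (hSys : tian2014_system_sMinus_autUnits) :
    CongruentSilentEvenFiveOrdTwo :=
  congruentSilentEvenFiveOrdTwo_of_autSystemListing_rankDescent (tian2014_system_sMinus_autListing_of_autUnits hSys)

/-- **Clause (a) on all of `𝒮⁻` from the units aut system display alone**: `ord_{s=1} L(E_{2pq}, s) = 1`.
[cite: TianYuanZhang2017, Thm. 1.1, Thm. 3.3] [cite: Tian2014, Prop. 2.1 (p0006 L23–L75), Notations (i)–(iii) (J122 L41–54)] [cite: Lagrange1975, §11 table p. 16-12] -/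
theorem analyticRank_eq_one_of_autSystemUnits_rankDescent (hSys : tian2014_system_sMinus_autUnits) :
    ∀ p q : ℕ, p.Prime → q.Prime → p % 8 = 5 → q % 4 = 3 → jacobiSym p q = -1 →
      (congruentNumberCurve (2 * (p * q))).analyticRank = 1 :=
  analyticRank_eq_one_of_autSystemListing_rankDescent (tian2014_system_sMinus_autListing_of_autUnits hSys)

/-- **Rank one on all of `𝒮⁻` from the units aut system display alone.** [cite: Lagrange1975, §11 table p. 16-12]
[cite: Monsky1990MockHeegner, Thm. 5.5 (p. 62), Thm. 5.9 (1) (pp. 63–64)] [cite: Tian2014, Prop. 2.1 (p0006 L23–L75), Notations (i)–(iii) (J122 L41–54)] -/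
theorem mordellWeilRank_eq_one_of_autSystemUnits_rankDescent (hSys : tian2014_system_sMinus_autUnits) :
    ∀ p q : ℕ, p.Prime → q.Prime → p % 8 = 5 → q % 4 = 3 → jacobiSym p q = -1 →
      (congruentNumberCurve (2 * (p * q))).mordellWeilRank = 1 :=
  mordellWeilRank_eq_one_of_autSystemListing_rankDescent (tian2014_system_sMinus_autListing_of_autUnits hSys)

/-- **Both typed forms of C-P2-1 on `𝒮⁻` from the units aut display ALONE.** CONDITIONAL; nothing asserted.
[cite: Tian2014, Def. 2.7, Prop. 2.1 (p0006 L23–L75), p0007 L28–L29, p0003 L3–L5 (J119), Notations (i)–(iii) (J122 L41–54)]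
[cite: TianYuanZhang2017, Thm. 3.3, J733, J741, J747, J751, Lemma 3.16 (J754)]
[cite: SilvermanAEC2009, Prop. X.1.4, Prop. X.4.9] [cite: Miller2011LMS, Def. 1.1] -/
theorem congruentSilentEvenFive_pair_of_autSystemUnits_descent (hSys : tian2014_system_sMinus_autUnits) :
    CongruentSilentEvenFiveOrdTwo ∧ CongruentSilentEvenFiveBSDTwo :=
  ⟨congruentSilentEvenFiveOrdTwo_of_autSystemUnits_rankDescent hSys,
    congruentSilentEvenFiveBSDTwo_of_autSystemUnits_descent hSys⟩

/-! ## §3 The two corners are interchangeable (the displayed facts are equivalent in the kernel) -/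

/-- **The listing corner and the units corner are the same theorem read through equivalent displays**: C-P2-1 follows from
`hSys¹¹` iff it follows from `hSys¹²`, because `hSys¹¹ ⟺ hSys¹²` (`tian2014_system_sMinus_autListing_iff_autUnits`).
[cite: Tian2014, Prop. 2.1 (p0006 L23–L75), p0007 L28–L29] [cite: TianYuanZhang2017, §3.2 (p0012 L16), Lemma 3.16 (p0017 L111)] -/
theorem autSystemListing_imp_bsdTwo_iff_autSystemUnits_imp_bsdTwo :
    (tian2014_system_sMinus_autListing → CongruentSilentEvenFiveBSDTwo) ↔
      (tian2014_system_sMinus_autUnits → CongruentSilentEvenFiveBSDTwo) :=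
  ⟨fun h hU => h (tian2014_system_sMinus_autListing_of_autUnits hU),
    fun h hL => h (tian2014_system_sMinus_autUnits_of_autListing hL)⟩

end Summit.BirchSwinnertonDyer.Rank1Residual.P2

end
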